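import Mathlib
import Summits.Ventures.PercRepro2.Defs
import Summits.Ventures.PercRepro2.Graph
import Summits.Ventures.PercRepro2.Induced
import Summits.Ventures.PercRepro2.BHKAvoid
import Summits.Ventures.PercRepro2.YBridge
import Summits.Ventures.PercRepro2.SevenKernel

/-!
# The seven-vertex skeleton in the tree's vocabulary, and the bitmask connectivity is `Conn` — for EVERY edge list
(blind cell PercRepro2, mine-2 g34; the first bridge file of the twelve-edge certificate `SevenKernel.lean`;
`Deg2Conn.lean` (mine-2 g26) with the graph itself the parameter)

`ends edge : Fin 12 → Sym2 (Fin 7)` is the graph with the endpoint list `edge : Fin 12 → Fin 7 × Fin 7` (loops and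
parallel edges allowed; `Seven.ea edge`, `Seven.eb edge` are its endpoints as numbers).  `conn_iff`: the bitmask
closure `Seven.conn edge ω u v` is exactly the tree's connection relation `Conn (ends edge) ω u v` — the six
closure steps `step` add the open neighbours of the reached vertices (`testBit_step`, `testBit_nb`), so a reached
vertex is reachable (`reachable_of_mem`) and every vertex at walk distance `≤ 6` is reached (`mem_of_walk`); a path
in a graph on seven vertices has length `≤ 6`.  Hence the side tables are the indicators of the tree's events
(`tQ_iff`, `tL_iff`, `tH_iff`, `tPD_iff`, `tPDoU_iff`).
-/

namespace Summit.Ventures.PercRepro2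

namespace Seven

/-! ## The graph as a graph of the tree -/

/-- The skeleton on the seven vertices, in the tree's vocabulary. -/
def ends (edge : Fin 12 → Fin 7 × Fin 7) : Fin 12 → Sym2 (Fin 7) := fun e => s((edge e).1, (edge e).2)

/-- The endpoints are below `7`. -/
lemma ea_lt (edge : Fin 12 → Fin 7 × Fin 7) (e : Fin 12) : ea edge e < 7 := (edge e).1.isLt

/-- The endpoints are below `7`. -/
lemma eb_lt (edge : Fin 12 → Fin 7 × Fin 7) (e : Fin 12) : eb edge e < 7 := (edge e).2.isLt

/-- `ends edge e = s(u, v)` iff `{ea e, eb e} = {u, v}`. -/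
lemma ends_eq_iff (edge : Fin 12 → Fin 7 × Fin 7) (e : Fin 12) (u v : Fin 7) :
    ends edge e = s(u, v) ↔ (ea edge e = u ∧ eb edge e = v) ∨ (eb edge e = u ∧ ea edge e = v) := by
  unfold ends ea eb
  rw [Sym2.eq_iff]
  constructor
  · rintro (⟨h1, h2⟩ | ⟨h1, h2⟩)
    · exact Or.inl ⟨by rw [h1], by rw [h2]⟩
    · exact Or.inr ⟨by rw [h2], by rw [h1]⟩
  · rintro (⟨h1, h2⟩ | ⟨h1, h2⟩)
    · exact Or.inl ⟨Fin.ext h1, Fin.ext h2⟩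
    · exact Or.inr ⟨Fin.ext h2, Fin.ext h1⟩

/-! ## Bits of the closure -/

/-- A fold of `lor`s: bit `v` of `l.foldl (· ||| h ·) acc` is bit `v` of `acc` or of some `h x`. -/
lemma testBit_foldl_lor {α : Type*} (h : α → ℕ) (v : ℕ) :
    ∀ (l : List α) (acc : ℕ),
      (l.foldl (fun acc x => acc ||| h x) acc).testBit v =
        (acc.testBit v || l.any fun x => (h x).testBit v)
  | [], acc => by simp
  | x :: l, acc => by
    rw [List.foldl_cons, testBit_foldl_lor h v l, Nat.testBit_lor, List.any_cons]
    simp only [Bool.or_assoc]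

/-- The neighbour contribution of one edge. -/
def nbEdge (edge : Fin 12 → Fin 7 × Fin 7) (ω : Fin 12 → Bool) (u : ℕ) (e : Fin 12) : ℕ :=
  if ω e then (if ea edge e = u then 1 <<< eb edge e else if eb edge e = u then 1 <<< ea edge e else 0) else 0

/-- `nb` is a fold of `lor`s of the edge contributions. -/
lemma nb_eq_foldl (edge : Fin 12 → Fin 7 × Fin 7) (ω : Fin 12 → Bool) (u : ℕ) :
    nb edge ω u = (List.finRange 12).foldl (fun acc e => acc ||| nbEdge edge ω u e) 0 := by
  unfold nb
  congr 1
  funext acc e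
  unfold nbEdge
  split_ifs <;> simp

/-- Bit `v` of `1 <<< k` is `v = k`. -/
lemma testBit_one_shiftLeft (k v : ℕ) : (1 <<< k).testBit v = decide (k = v) := by
  rw [Nat.one_shiftLeft, Nat.testBit_two_pow]

/-- **Bit `v` of the neighbour mask of `u`**: some open edge joins `u` and `v`. -/
lemma testBit_nb (edge : Fin 12 → Fin 7 × Fin 7) (ω : Fin 12 → Bool) (u v : ℕ) :
    (nb edge ω u).testBit v = true ↔
      ∃ e, ω e = true ∧ ((ea edge e = u ∧ eb edge e = v) ∨ (eb edge e = u ∧ ea edge e = v)) := by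
  rw [nb_eq_foldl, testBit_foldl_lor, Nat.zero_testBit, Bool.false_or, List.any_eq_true]
  constructor
  · rintro ⟨e, -, he⟩
    unfold nbEdge at he
    refine ⟨e, ?_⟩
    by_cases hω : ω e = true
    · rw [if_pos hω] at he
      refine ⟨hω, ?_⟩
      by_cases h1 : ea edge e = u
      · rw [if_pos h1, testBit_one_shiftLeft, decide_eq_true_iff] at he
        exact Or.inl ⟨h1, he⟩
      · rw [if_neg h1] at he
        by_cases h2 : eb edge e = u
        · rw [if_pos h2, testBit_one_shiftLeft, decide_eq_true_iff] at he
          exact Or.inr ⟨h2, he⟩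
        · rw [if_neg h2, Nat.zero_testBit] at he
          exact absurd he Bool.false_ne_true
    · rw [if_neg hω, Nat.zero_testBit] at he
      exact absurd he Bool.false_ne_true
  · rintro ⟨e, hω, h⟩
    refine ⟨e, List.mem_finRange e, ?_⟩
    unfold nbEdge
    rw [if_pos hω]
    by_cases h1 : ea edge e = u
    · rw [if_pos h1, testBit_one_shiftLeft, decide_eq_true_iff]
      rcases h with ⟨_, h2⟩ | ⟨h2, h3⟩
      · exact h2
      · -- a loop at `u = v`
        rw [h2, ← h1, h3]
    · rw [if_neg h1]
      rcases h with ⟨h2, _⟩ | ⟨h2, h3⟩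
      · exact absurd h2 h1
      · rw [if_pos h2, testBit_one_shiftLeft, decide_eq_true_iff]; exact h3

/-- The contribution of one vertex to a closure step. -/
def stepV (edge : Fin 12 → Fin 7 × Fin 7) (ω : Fin 12 → Bool) (R : ℕ) (u : ℕ) : ℕ :=
  if R.testBit u then nb edge ω u else 0

/-- `step` is a fold of `lor`s. -/
lemma step_eq_foldl (edge : Fin 12 → Fin 7 × Fin 7) (ω : Fin 12 → Bool) (R : ℕ) :
    step edge ω R = (List.range 7).foldl (fun acc u => acc ||| stepV edge ω R u) R := by
  unfold step
  congr 1
  funext acc u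
  unfold stepV
  split_ifs <;> simp

/-- **Bit `v` of a closure step**: `v` was reached, or some reached `u < 7` has `v` as an open
neighbour. -/
lemma testBit_step (edge : Fin 12 → Fin 7 × Fin 7) (ω : Fin 12 → Bool) (R : ℕ) (v : ℕ) :
    (step edge ω R).testBit v = true ↔
      R.testBit v = true ∨ ∃ u, u < 7 ∧ R.testBit u = true ∧ (nb edge ω u).testBit v = true := by
  rw [step_eq_foldl, testBit_foldl_lor, Bool.or_eq_true, List.any_eq_true]
  constructor
  · rintro (h | ⟨u, hu, h⟩)
    · exact Or.inl h
    · unfold stepV at h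
      by_cases hR : R.testBit u = true
      · rw [if_pos hR] at h
        exact Or.inr ⟨u, List.mem_range.1 hu, hR, h⟩
      · rw [if_neg hR, Nat.zero_testBit] at h
        exact absurd h Bool.false_ne_true
  · rintro (h | ⟨u, hu, hR, h⟩)
    · exact Or.inl h
    · refine Or.inr ⟨u, List.mem_range.2 hu, ?_⟩
      unfold stepV
      rw [if_pos hR]
      exact h

/-- Bits are preserved by a closure step. -/
lemma testBit_step_of_testBit (edge : Fin 12 → Fin 7 × Fin 7) (ω : Fin 12 → Bool) (R : ℕ) {v : ℕ}
    (h : R.testBit v = true) : (step edge ω R).testBit v = true :=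
  (testBit_step edge ω R v).2 (Or.inl h)

/-! ## The closure is reachability -/

/-- The iterated closure. -/
def reachN (edge : Fin 12 → Fin 7 × Fin 7) (ω : Fin 12 → Bool) (u : ℕ) : ℕ → ℕ
  | 0 => 1 <<< u
  | n + 1 => step edge ω (reachN edge ω u n)

/-- `reach` is the six-fold closure. -/
lemma reach_eq (edge : Fin 12 → Fin 7 × Fin 7) (ω : Fin 12 → Bool) (u : ℕ) :
    reach edge ω u = reachN edge ω u 6 := rfl

/-- The closures are increasing. -/
lemma testBit_reachN_succ (edge : Fin 12 → Fin 7 × Fin 7) (ω : Fin 12 → Bool) (u : ℕ) {n v : ℕ}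
    (h : (reachN edge ω u n).testBit v = true) : (reachN edge ω u (n + 1)).testBit v = true :=
  testBit_step_of_testBit edge ω _ h

/-- The closures are increasing (general form). -/
lemma testBit_reachN_of_le (edge : Fin 12 → Fin 7 × Fin 7) (ω : Fin 12 → Bool) (u : ℕ) {n m v : ℕ}
    (hnm : n ≤ m) (h : (reachN edge ω u n).testBit v = true) : (reachN edge ω u m).testBit v = true := by
  induction hnm with
  | refl => exact h
  | step _ ih => exact testBit_reachN_succ edge ω u ih

/-- An open neighbour of a reached vertex is reached one step later. -/
lemma testBit_reachN_succ_of_adj (edge : Fin 12 → Fin 7 × Fin 7) (ω : Fin 12 → Bool) (u : ℕ) {n : ℕ}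
    {a b : Fin 7} (ha : (reachN edge ω u n).testBit a = true) (hab : OpenAdj (ends edge) ω a b) :
    (reachN edge ω u (n + 1)).testBit b = true := by
  refine (testBit_step edge ω _ b).2 (Or.inr ⟨a, a.isLt, ha, ?_⟩)
  rw [testBit_nb]
  obtain ⟨e, he, hends⟩ := hab
  exact ⟨e, he, (ends_eq_iff edge e a b).1 hends⟩

/-- Soundness: a reached vertex is connected to the root. -/
lemma reachable_of_mem (edge : Fin 12 → Fin 7 × Fin 7) (ω : Fin 12 → Bool) (u v : Fin 7) :
    ∀ {n : ℕ}, (reachN edge ω u n).testBit v = true → Conn (ends edge) ω u v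
  | 0, h => by
    rw [reachN, testBit_one_shiftLeft, decide_eq_true_iff] at h
    rw [Fin.ext h]
    exact conn_refl (ends edge) ω v
  | n + 1, h => by
    rw [reachN, testBit_step] at h
    rcases h with h | ⟨a, ha7, ha, hav⟩
    · exact reachable_of_mem edge ω u v h
    · rw [testBit_nb] at hav
      obtain ⟨e, he, hev⟩ := hav
      have hadj : OpenAdj (ends edge) ω ⟨a, ha7⟩ v :=
        ⟨e, he, (ends_eq_iff edge e ⟨a, ha7⟩ v).2 hev⟩
      have hreach : Conn (ends edge) ω u ⟨a, ha7⟩ := reachable_of_mem edge ω u ⟨a, ha7⟩ ha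
      by_cases hne : (⟨a, ha7⟩ : Fin 7) = v
      · rw [← hne]; exact hreach
      · exact hreach.trans ((openGraph_adj.2 ⟨hne, hadj⟩).reachable)

/-- Completeness along a walk: a walk of length `l` from a reached vertex ends in a vertex reached
`l` steps later. -/
lemma mem_of_walk (edge : Fin 12 → Fin 7 × Fin 7) (ω : Fin 12 → Bool) (u : ℕ) {a v : Fin 7}
    (p : (openGraph (ends edge) ω).Walk a v) :
    ∀ {n : ℕ}, (reachN edge ω u n).testBit a = true →
      (reachN edge ω u (n + p.length)).testBit v = true := by
  induction p with
  | nil => intro n ha; simpa using ha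
  | cons hadj _ ih =>
    intro n ha
    have := ih (testBit_reachN_succ_of_adj edge ω u ha (openGraph_adj.1 hadj).2)
    rw [SimpleGraph.Walk.length_cons, ← Nat.add_assoc]
    rwa [Nat.add_right_comm] at this

/-- **The bitmask closure is connectivity**: `conn ω u v = true ↔ Conn (ends edge) ω u v`. -/
theorem conn_iff (edge : Fin 12 → Fin 7 × Fin 7) (ω : Fin 12 → Bool) (u v : Fin 7) :
    conn edge ω u v = true ↔ Conn (ends edge) ω u v := by
  unfold conn
  rw [reach_eq]
  refine ⟨reachable_of_mem edge ω u v, fun h => ?_⟩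
  refine h.elim_path fun p => ?_
  have hlen : p.1.length ≤ 6 := by
    have := p.2.length_lt
    rw [Fintype.card_fin] at this
    omega
  have hmem : (reachN edge ω u (0 + p.1.length)).testBit v = true :=
    mem_of_walk edge ω u p.1 (by rw [reachN, testBit_one_shiftLeft]; simp)
  exact testBit_reachN_of_le edge ω u (by omega) hmem

/-- `conn` on numbers below `7`, for the tables. -/
lemma conn_iff' (edge : Fin 12 → Fin 7 × Fin 7) (ω : Fin 12 → Bool) {u v : ℕ} (hu : u < 7) (hv : v < 7) :
    conn edge ω u v = true ↔ Conn (ends edge) ω ⟨u, hu⟩ ⟨v, hv⟩ :=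
  conn_iff edge ω ⟨u, hu⟩ ⟨v, hv⟩

/-! ## The side tables are the tree's events -/

/-- The connection `u ↔ v` for numerals, as a set membership. -/
lemma conn_iff_mem (edge : Fin 12 → Fin 7 × Fin 7) (ω : Fin 12 → Bool) {u v : ℕ} (hu : u < 7) (hv : v < 7) :
    conn edge ω u v = true ↔ ω ∈ connEvent (ends edge) ⟨u, hu⟩ ⟨v, hv⟩ :=
  conn_iff' edge ω hu hv

/-- `tQ ω ↔ ω ∈ Q = {a₁ ↮ a₂}`. -/
lemma tQ_iff (edge : Fin 12 → Fin 7 × Fin 7) (ω : Fin 12 → Bool) :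
    tQ edge ω = true ↔ ω ∈ avoidAll (ends edge) 2 {1} := by
  unfold tQ
  rw [Bool.not_eq_true', Bool.eq_false_iff, Ne, conn_iff' edge ω (by norm_num) (by norm_num)]
  simp only [mem_avoidAll, Finset.mem_singleton, forall_eq]
  exact ⟨fun h hc => h (conn_symm hc), fun h hc => h (conn_symm hc)⟩

/-- `tL v ω ↔ ω ∈ {v ∈ C₁}`. -/
lemma tL_iff (edge : Fin 12 → Fin 7 × Fin 7) (v : Fin 7) (ω : Fin 12 → Bool) :
    tL edge v ω = true ↔ ω ∈ connEvent (ends edge) 1 v :=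
  conn_iff_mem edge ω (by norm_num) v.isLt

/-- `tH v ω ↔ ω ∈ {v ∈ C₂}`. -/
lemma tH_iff (edge : Fin 12 → Fin 7 × Fin 7) (v : Fin 7) (ω : Fin 12 → Bool) :
    tH edge v ω = true ↔ ω ∈ connEvent (ends edge) 2 v :=
  conn_iff_mem edge ω (by norm_num) v.isLt

/-- `tPD ω ↔ ω ∈ PD = Q ∩ {a₃ ∉ C₁ ∪ C₂}`. -/
lemma tPD_iff (edge : Fin 12 → Fin 7 × Fin 7) (ω : Fin 12 → Bool) :
    tPD edge ω = true ↔ ω ∈ PDEvent (ends edge) 1 2 3 := by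
  unfold tPD tL tH PDEvent Dtilde UnionCluster.inU
  rw [Bool.and_eq_true, Bool.and_eq_true, tQ_iff, Bool.not_eq_true', Bool.not_eq_true',
    Bool.eq_false_iff, Bool.eq_false_iff, Ne, Ne, conn_iff' edge ω (by norm_num) (by norm_num),
    conn_iff' edge ω (by norm_num) (by norm_num)]
  simp only [mem_avoidAll, Finset.mem_singleton, forall_eq, Set.mem_inter_iff, Set.mem_compl_iff,
    Set.mem_union, mem_connEvent]
  constructor
  · rintro ⟨⟨hQ, h13⟩, h23⟩
    exact ⟨fun h => hQ (conn_symm h), fun h => h.elim (fun h => h13 (conn_symm h))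
      (fun h => h23 (conn_symm h))⟩
  · rintro ⟨hQ, h⟩
    exact ⟨⟨fun h' => hQ (conn_symm h'), fun h' => h (Or.inl (conn_symm h'))⟩,
      fun h' => h (Or.inr (conn_symm h'))⟩

/-- `tPDoU ω ↔ ω ∈ PD ∩ {o ∈ C₁ ∪ C₂}`. -/
lemma tPDoU_iff (edge : Fin 12 → Fin 7 × Fin 7) (ω : Fin 12 → Bool) :
    tPDoU edge ω = true ↔
      ω ∈ PDEvent (ends edge) 1 2 3 ∩ (connEvent (ends edge) 1 0 ∪ connEvent (ends edge) 2 0) := by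
  unfold tPDoU tU tL tH
  rw [Bool.and_eq_true, tPD_iff, Bool.or_eq_true, conn_iff_mem edge ω (by norm_num) (by norm_num),
    conn_iff_mem edge ω (by norm_num) (by norm_num)]
  exact Iff.rfl

end Seven

end Summit.Ventures.PercRepro2
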